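import Literature.AnabelianGeometry.EtaleTheta.SettingModelGfpTwistTempered
import HarnessLib

/-!
# Root models of [EtTh] §1 (R78, stages 1 AND 2): `Γ ⋊_Θ G` is TEMPERED for EVERY action of a profinite `G` on
# `Γ = F̂₂ ×_Ẑ ℤ` through continuous automorphisms of `F̂₂` preserving the degree (proof-only; «F4q-c GENERIC»)

Mochizuki, *Semi-graphs of anabelioids*, Publ. RIMS **42** (2006) [SemiAnbd], Def. 3.1 (i) p. 33, Ex. 3.10 p. 43
(«`π₁^temp(X_K)` … tempered») [cite: MochizukiSemiAnbd2006, Def 3.1(i) p.33]; [EtTh] §1 p. 12 (`Π^tp_X`, `G_K`)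
[cite: MochizukiEtTh2009, §1 p.12]; [AbsTopI] §0 p. 9 (characteristic open subgroups of a topologically finitely
generated profinite group) [cite: MochizukiAbsTopI2012, §0 p.9].  abc-iut cell, seat abc-iut-w5-d111 (gen 4); R78
cluster, STAGE 2 («Tate shear» model `χq`, abc-iut-L6-d6's MAP #5): the slot «F4q-c temperedness of `PiTpχq`» made
ACTION-GENERIC so that it waits on no carrier.  PROOF-ONLY (0 definitions), generalising this seat's
`twistGfp_condition_T` / `isTempered_gfp_twist_semidirect` (SettingModelGfpTwistTempered, p429546) from the
`Ẑ^×`-twist `φ = twistGfp ∘ χ` to an ARBITRARY action: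

* **`gfp_condition_T_of_action`** — let a profinite `G` act on `Γ` by `φ : G →* MulAut Γ` whose `F̂₂`-component is an
  action `Θ : G →* MulAut F̂₂` by CONTINUOUS automorphisms (`(φ σ q).1 = Θ σ q.1`) preserving the degree
  (`(φ σ q).2 = q.2`), with `σ ↦ Θ σ x` continuous for each `x`.  Then the pro-discrete continuity hypothesis (T) of
  `Semidirect.isTempered_semidirect` holds: an open normal `N₁ ≤ Γ` contains a slice `(V × 0) ∩ Γ`, `V` contains a
  CHARACTERISTIC open `V₀` ([AbsTopI] §0 — `F̂₂` is topologically finitely generated), so `N₂ := (V₀ × 0) ∩ Γ` is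
  stable under EVERY `φ σ` WHATEVER THE ACTION, and `W := Ker(G → Aut(F̂₂/V₀))` is an open normal subgroup acting
  trivially modulo `N₂` — open because it contains `{σ | Θ σ (η a)·(η a)⁻¹ ∈ V₀} ∩ {σ | Θ σ (η b)·(η b)⁻¹ ∈ V₀}` (the
  fixator `{x | Θ σ x · x⁻¹ ∈ V₀}` is a closed subgroup, and a closed subgroup containing `η a`, `η b` is everything).
  Unlike the stage-1 proof no generator needs to be FIXED by the action — so the affine «Tate shear»
  `a ↦ a·b^k·c^m`, `b ↦ b^u` of stage 2 is covered.
* **`isTempered_gfp_semidirect_of_action`** — hence `Γ ⋊[φ] G` is tempered for any group topology making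
  `(left, right)` a topological embedding.
* an `example` re-derives the stage-1 theorem `isTempered_gfp_twist_semidirect` as the instance `Θ := twistHom ∘ χ`.
Semi-synthetic model plumbing, consistency evidence only; classical topological group theory; nothing of [EtTh]
asserted; no side taken on [IUTchIII] Cor. 3.12.
-/

noncomputable section

namespace Literature.AnabelianGeometry.EtaleTheta.SettingModel

open Literature.AnabelianGeometry.SemiGraphs Literature.AnabelianGeometry.AbsoluteAnabelian
open _root_.Topology _root_.Filter Function

/-- A `MulAut`-valued action by continuous automorphisms consists of automorphisms of the TOPOLOGICAL group `F̂₂`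
(the inverse `Θ σ⁻¹` is continuous too). [cite: MochizukiAbsTopI2012, §0 p.9] -/
theorem continuous_symm_of_action {G : Type*} [Group G] (Θ : G →* MulAut F₂hatT)
    (hΘc : ∀ σ, Continuous (Θ σ)) (σ : G) : Continuous (Θ σ).symm := by
  have h : ((Θ σ).symm : F₂hatT → F₂hatT) = Θ σ⁻¹ := by
    rw [map_inv]; rfl
  rw [h]
  exact hΘc σ⁻¹

/-- **The hypothesis (T) of `Semidirect.isTempered_semidirect` holds for EVERY action of a profinite group on
`Γ = F̂₂ ×_Ẑ ℤ` through continuous automorphisms of `F̂₂` preserving the degree** (pointwise continuous in the group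
variable): every open normal `N₁ ≤ Γ` contains an open normal `N₂ = (V₀ × 0) ∩ Γ` (`V₀ ≤ F̂₂` characteristic open)
stable under all of `φ(G)`, modulo which the open normal subgroup `W = Ker(G → Aut(F̂₂/V₀))` acts trivially.
[cite: MochizukiAbsTopI2012, §0 p.9] -/
theorem gfp_condition_T_of_action {G : Type*} [Group G] [TopologicalSpace G] [IsTopologicalGroup G]
    [CompactSpace G] [TotallyDisconnectedSpace G]
    (Θ : G →* MulAut F₂hatT) (hΘc : ∀ σ, Continuous (Θ σ)) (hcont : ∀ x : F₂hatT, Continuous fun σ => Θ σ x)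
    {φ : G →* MulAut Gfp}
    (hφ : ∀ (σ : G) (q : Gfp), ((φ σ q : Gfp) : F₂hatT × Multiplicative ℤ) =
      (Θ σ (q : F₂hatT × Multiplicative ℤ).1, (q : F₂hatT × Multiplicative ℤ).2))
    (N₁ : OpenNormalSubgroup Gfp) :
    ∃ N₂ : OpenNormalSubgroup Gfp, N₂ ≤ N₁ ∧
      (∀ g : G, ∀ ⦃a⦄, a ∈ (N₂ : Subgroup Gfp) → φ g a ∈ (N₂ : Subgroup Gfp)) ∧
      ∃ W : OpenNormalSubgroup G, ∀ ⦃b⦄, b ∈ (W : Subgroup G) → ∀ n : Gfp,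
        n * (φ b n)⁻¹ ∈ (N₂ : Subgroup Gfp) := by
  classical
  -- the automorphisms of the topological group `F̂₂` given by the action
  let Θc : G → (F₂hatT ≃ₜ* F₂hatT) := fun σ =>
    { (Θ σ : F₂hatT ≃* F₂hatT) with
      continuous_toFun := hΘc σ
      continuous_invFun := continuous_symm_of_action Θ hΘc σ }
  have hΘc_apply : ∀ σ x, Θc σ x = Θ σ x := fun _ _ => rfl
  -- Step A: a slice `(V × 0) ∩ Γ ⊆ N₁`
  obtain ⟨V, N, -, hN, hNN₁⟩ := TemperedFibreProduct.exists_openNormal_le_of_mem_nhds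
    (P := F₂hatT) Gfp (N₁.toOpenSubgroup.mem_nhds_one)
  -- Step B: a characteristic open normal `V₀ ≤ V`
  haveI : Finite (F₂hatT ⧸ (V : Subgroup F₂hatT)) := Subgroup.quotient_finite_of_isOpen _ V.isOpen
  haveI : (V : Subgroup F₂hatT).FiniteIndex := Subgroup.finiteIndex_of_finite_quotient
  obtain ⟨V₀, hV₀n, hV₀o, -, hV₀c, hV₀V⟩ :=
    isTopologicallyFinitelyGenerated_F₂hat.exists_charOpen_normal_le (V : Subgroup F₂hatT) V.isOpen
  haveI := hV₀n
  let V₀' : OpenNormalSubgroup F₂hatT := { toSubgroup := V₀, isOpen' := hV₀o, isNormal' := hV₀n }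
  have hV₀Θ : ∀ (σ : G) {x : F₂hatT}, x ∈ V₀ → Θ σ x ∈ V₀ := by
    intro σ x hx
    have h := hV₀c (Θc σ)
    rw [← h]
    exact Subgroup.mem_map_of_mem _ hx
  obtain ⟨N₂, -, hN₂⟩ := TemperedFibreProduct.exists_openNormal_mem_iff (P := F₂hatT) Gfp V₀'
  have hN₂mem : ∀ q : Gfp, q ∈ (N₂ : Subgroup Gfp) ↔
      (q : F₂hatT × Multiplicative ℤ).1 ∈ V₀ ∧ (q : F₂hatT × Multiplicative ℤ).2 = 1 := fun q => hN₂ q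
  refine ⟨N₂, ?_, ?_, ?_⟩
  · -- `N₂ ≤ N ≤ N₁`
    intro q hq
    have hq' := (hN₂ q).mp hq
    exact hNN₁ ((hN q).mpr ⟨hV₀V hq'.1, hq'.2⟩)
  · -- stability under `φ(G)`: `V₀` is characteristic and the degree is preserved
    intro g q hq
    rw [hN₂mem] at hq ⊢
    rw [hφ]
    exact ⟨hV₀Θ _ hq.1, hq.2⟩
  · -- Step C: `W = Ker(G → Aut(F̂₂/V₀))`
    have hsub : ∀ σ : G, (∀ x : F₂hatT, Θ σ x * x⁻¹ ∈ V₀) → ∀ x : F₂hatT, x * (Θ σ x)⁻¹ ∈ V₀ := by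
      intro σ h x
      have := V₀.inv_mem (h x)
      rwa [mul_inv_rev, inv_inv] at this
    let S : Set G := {σ | ∀ x : F₂hatT, Θ σ x * x⁻¹ ∈ V₀}
    obtain ⟨W, hW⟩ : ∃ W : Subgroup G, ∀ σ, σ ∈ W ↔ ∀ x : F₂hatT, Θ σ x * x⁻¹ ∈ V₀ := by
      refine ⟨⟨⟨⟨S, ?_⟩, ?_⟩, ?_⟩, fun σ => Iff.rfl⟩
      · intro σ τ hσ hτ x
        simp only [S, Set.mem_setOf_eq] at hσ hτ ⊢
        rw [map_mul, MulAut.mul_apply]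
        have e : Θ σ (Θ τ x) * x⁻¹ = (Θ σ (Θ τ x) * (Θ τ x)⁻¹) * (Θ τ x * x⁻¹) := by group
        rw [e]
        exact V₀.mul_mem (hσ _) (hτ x)
      · intro x
        simp only [map_one, MulAut.one_apply, mul_inv_cancel]
        exact V₀.one_mem
      · intro σ hσ x
        simp only [S, Set.mem_setOf_eq] at hσ ⊢
        -- `x = Θ σ (Θ σ⁻¹ x)`
        have hx : Θ σ (Θ σ⁻¹ x) = x := by
          rw [← MulAut.mul_apply, ← map_mul, mul_inv_cancel, map_one, MulAut.one_apply]
        have h := V₀.inv_mem (hσ (Θ σ⁻¹ x))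
        rw [hx, mul_inv_rev, inv_inv] at h
        exact h
    -- `W` is normal
    have hWn : W.Normal := by
      refine ⟨fun σ hσ τ => ?_⟩
      rw [hW] at hσ ⊢
      intro x
      set y := Θ τ⁻¹ x with hy
      have hx : Θ τ y = x := by
        rw [hy, ← MulAut.mul_apply (e₁ := Θ τ), ← map_mul, mul_inv_cancel, map_one, MulAut.one_apply]
      have key : Θ (τ * σ * τ⁻¹) x * x⁻¹ = Θ τ (Θ σ y * y⁻¹) := by
        calc Θ (τ * σ * τ⁻¹) x * x⁻¹ = Θ τ (Θ σ (Θ τ⁻¹ x)) * x⁻¹ := by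
              rw [map_mul, map_mul, MulAut.mul_apply, MulAut.mul_apply]
          _ = Θ τ (Θ σ y) * (Θ τ y)⁻¹ := by rw [← hy, hx]
          _ = Θ τ (Θ σ y * y⁻¹) := by rw [map_mul (Θ τ), map_inv (Θ τ)]
      rw [key]
      exact hV₀Θ _ (hσ y)
    -- `W` contains the open set `{σ | Θ σ (η a)(η a)⁻¹ ∈ V₀} ∩ {σ | Θ σ (η b)(η b)⁻¹ ∈ V₀}`, hence is open
    let S₀ : Set G := {σ : G | Θ σ (eta (FreeGroup.of 0)) * (eta (FreeGroup.of 0))⁻¹ ∈ V₀}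
    let S₁ : Set G := {σ : G | Θ σ (eta (FreeGroup.of 1)) * (eta (FreeGroup.of 1))⁻¹ ∈ V₀}
    have hS₀ : IsOpen S₀ := hV₀o.preimage ((hcont _).mul continuous_const)
    have hS₁ : IsOpen S₁ := hV₀o.preimage ((hcont _).mul continuous_const)
    have hSW : S₀ ∩ S₁ ⊆ (W : Set G) := by
      rintro σ ⟨hσ₀, hσ₁⟩
      rw [SetLike.mem_coe, hW]
      -- the fixator `{x | Θ σ x · x⁻¹ ∈ V₀}` is a closed subgroup containing `η a`, `η b`
      let F : Set F₂hatT := {x | Θ σ x * x⁻¹ ∈ V₀}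
      obtain ⟨Fix, hFix⟩ : ∃ Fix : Subgroup F₂hatT, ∀ x, x ∈ Fix ↔ Θ σ x * x⁻¹ ∈ V₀ := by
        refine ⟨⟨⟨⟨F, ?_⟩, ?_⟩, ?_⟩, fun x => Iff.rfl⟩
        · intro x y hx hy
          simp only [F, Set.mem_setOf_eq] at hx hy ⊢
          rw [map_mul]
          have e : Θ σ x * Θ σ y * (x * y)⁻¹ = (Θ σ x * x⁻¹) * (x * (Θ σ y * y⁻¹) * x⁻¹) := by group
          rw [e]
          exact V₀.mul_mem hx (hV₀n.conj_mem _ hy x)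
        · show Θ σ 1 * 1⁻¹ ∈ V₀
          rw [map_one, inv_one, mul_one]
          exact V₀.one_mem
        · intro x hx
          simp only [F, Set.mem_setOf_eq] at hx ⊢
          rw [map_inv, inv_inv]
          have h1 : x * (Θ σ x)⁻¹ ∈ V₀ := by
            have := V₀.inv_mem hx
            rwa [mul_inv_rev, inv_inv] at this
          have h2 := hV₀n.conj_mem _ h1 x⁻¹
          rwa [inv_inv, ← mul_assoc, inv_mul_cancel, one_mul] at h2
      have hFixc : IsClosed (Fix : Set F₂hatT) := by
        have e : (Fix : Set F₂hatT) = (fun x => Θ σ x * x⁻¹) ⁻¹' (V₀ : Set F₂hatT) := by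
          ext x; exact hFix x
        rw [e]
        exact (OpenSubgroup.isClosed ⟨V₀, hV₀o⟩).preimage ((hΘc σ).mul continuous_inv)
      have hFix0 : eta (FreeGroup.of 0) ∈ Fix := (hFix _).mpr hσ₀
      have hFix1 : eta (FreeGroup.of 1) ∈ Fix := (hFix _).mpr hσ₁
      have htop := eq_top_of_isClosed_of_eta_mem Fix hFixc hFix0 hFix1
      intro x
      exact (hFix x).mp (htop ▸ Subgroup.mem_top x)
    have h1S : (1 : G) ∈ S₀ ∩ S₁ := by
      constructor
      · show Θ 1 (eta (FreeGroup.of 0)) * (eta (FreeGroup.of 0))⁻¹ ∈ V₀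
        rw [map_one, MulAut.one_apply, mul_inv_cancel]
        exact V₀.one_mem
      · show Θ 1 (eta (FreeGroup.of 1)) * (eta (FreeGroup.of 1))⁻¹ ∈ V₀
        rw [map_one, MulAut.one_apply, mul_inv_cancel]
        exact V₀.one_mem
    have hWo : IsOpen (W : Set G) :=
      Subgroup.isOpen_of_mem_nhds W (Filter.mem_of_superset ((hS₀.inter hS₁).mem_nhds h1S) hSW)
    refine ⟨{ toSubgroup := W, isOpen' := hWo, isNormal' := hWn }, fun b hb n => ?_⟩
    have hb' : ∀ x : F₂hatT, Θ b x * x⁻¹ ∈ V₀ := (hW b).mp hb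
    rw [hN₂mem]
    refine ⟨?_, ?_⟩
    · show ((n : F₂hatT × Multiplicative ℤ) * ((φ b n : Gfp) : F₂hatT × Multiplicative ℤ)⁻¹).1 ∈ V₀
      rw [hφ, Prod.fst_mul, Prod.fst_inv]
      exact hsub b hb' _
    · show ((n : F₂hatT × Multiplicative ℤ) * ((φ b n : Gfp) : F₂hatT × Multiplicative ℤ)⁻¹).2 = 1
      rw [hφ, Prod.snd_mul, Prod.snd_inv, mul_inv_cancel]

/-- **`Γ ⋊[φ] G` is tempered for EVERY action of a profinite `G` on `Γ = F̂₂ ×_Ẑ ℤ` through continuous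
automorphisms of `F̂₂` preserving the degree** (pointwise continuous in `σ`), for ANY group topology on `Γ ⋊[φ] G`
making `(left, right)` a topological embedding ([SemiAnbd] Def. 3.1 (i) / Ex. 3.10 at the root models: stage 1 = the
`Ẑ^×`-twist, stage 2 = the affine «Tate shear»). [cite: MochizukiSemiAnbd2006, Ex 3.10 p.43] -/
theorem isTempered_gfp_semidirect_of_action {G : Type*} [Group G] [TopologicalSpace G] [IsTopologicalGroup G]
    [CompactSpace G] [T2Space G] [TotallyDisconnectedSpace G]
    (Θ : G →* MulAut F₂hatT) (hΘc : ∀ σ, Continuous (Θ σ)) (hcont : ∀ x : F₂hatT, Continuous fun σ => Θ σ x)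
    {φ : G →* MulAut Gfp}
    (hφ : ∀ (σ : G) (q : Gfp), ((φ σ q : Gfp) : F₂hatT × Multiplicative ℤ) =
      (Θ σ (q : F₂hatT × Multiplicative ℤ).1, (q : F₂hatT × Multiplicative ℤ).2))
    [TopologicalSpace (Gfp ⋊[φ] G)] [IsTopologicalGroup (Gfp ⋊[φ] G)]
    (hι : IsInducing fun g : Gfp ⋊[φ] G => (g.left, g.right)) : IsTempered (Gfp ⋊[φ] G) :=
  Semidirect.isTempered_semidirect hι isTempered_gfp (gfp_condition_T_of_action Θ hΘc hcont hφ)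

/- Sanity instance (stage 1 re-derived, an `example` — the theorem itself is `isTempered_gfp_twist_semidirect`,
p429546): the `Ẑ^×`-twist action `φ = twistGfp ∘ χ` is the case `Θ := twistHom ∘ χ` of
`isTempered_gfp_semidirect_of_action`. -/
example {G : Type*} [Group G] [TopologicalSpace G] [IsTopologicalGroup G]
    [CompactSpace G] [T2Space G] [TotallyDisconnectedSpace G]
    (χ : G →* MulAut ZH) (hcont : ∀ x : F₂hatT, Continuous fun σ => twist (χ σ) x)
    {φ : G →* MulAut Gfp} (hφ : ∀ (σ : G) (q : Gfp), φ σ q = twistGfp (χ σ) q)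
    [TopologicalSpace (Gfp ⋊[φ] G)] [IsTopologicalGroup (Gfp ⋊[φ] G)]
    (hι : IsInducing fun g : Gfp ⋊[φ] G => (g.left, g.right)) : IsTempered (Gfp ⋊[φ] G) :=
  isTempered_gfp_semidirect_of_action (twistHom.comp χ) (fun σ => (twist (χ σ)).continuous) hcont
    (fun σ q => by rw [hφ, coe_twistGfp]; rfl) hι

end Literature.AnabelianGeometry.EtaleTheta.SettingModel

end
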